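import Summits.ABC.IUTFork.Cor312Statement
import HarnessLib

/-!
# [IUTchIII] Cor. 3.12, verbatim form — multiradiality as functorial invariance of the output data

Record-only file (D-0012) of the abc-iut cell (D-0067 Cor. 3.12 strategy TEAM C «étale-picture /
multiradiality», seat abc-iut-c312-13, row C-1 of `HOME/plan/C312-TEAMS.md`); TAKES NO SIDE. The statement
of [IUTchIII] Corollary 3.12 (kurims `paper:url-4b091feeb646`, p. 173 l. 41 – p. 174 l. 19) declares its
Θ-side quantity "subject to the indeterminacies (Ind1), (Ind2), (Ind3)" (p. 173 l. 49 – p. 174 l. 3) — i.e.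
the quantity is to be WELL-DEFINED on the `R^LGP`-class of the multiradial representation ([IUTchIII]
Thm. 3.11 (i), p. 154; c312-1 `Thm311.MRData.RLGP`). This file proves that well-definedness for the frozen
verbatim setting `Cor312.Setting` (abc-iut-c312-7, `Cor312Statement.lean`), as PURE ORBIT ALGEBRA over the
group `Cor312.indGroup S = ⟨Ind1Family ∪ Ind2Family⟩` — no volume, admissibility or boundedness hypothesis
enters anywhere in this file:

* §1 SELF-INVARIANCE: every element of `indGroup S` permutes the possible images of the Θ-pilot object and
  fixes their union (`image_mem_possibleImages`, `image_possibleImages_eq`, `image_sUnion_possibleImages`) —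
  the set the holomorphic hull `^{n,∘}𝒰_{j,v_ℚ}` is taken of (proof of Cor. 3.12, p. 174 l. 50 – p. 175 l. 1)
  is itself a fixed point of the indeterminacy action, the typed form of "the multiradial representation is
  already considered up to (Ind1), (Ind2)".
* §2 OUTPUT-DATA CONGRUENCE toolkit: two settings over the same situation with the same column, hull frames
  and q-regions, whose possible images agree, have the same `thetaHull`/`thetaLocal`/`negLogTheta`/`negLogQ`,
  and equivalent `Statement` (`statement_congr` and friends) — the interface consumers (Teams A/B/R) can
  instantiate for any identification that fixes those data.
* §3 KUMMER-GLUE TWIST: post-composing the Kummer glue `thetaRegionOf` (Thm. 3.11 (ii), RESIDUAL R1 of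
  `Cor312Statement.lean`) by ANY `Φ₀ ∈ indGroup S` yields a setting with the SAME possible images, hence the
  same `−|log(Θ)|`, the same `−|log(q)|`, and an equivalent `Statement` (`twistGlue_statement_iff`) — the
  kernel form of "re-choosing the Kummer identification within its (Ind1)(Ind2)-indeterminacy changes no
  output of the multiradial algorithm". This is the functorial invariance the proof's Step (ii) ("the various
  Kummer isomorphisms", p. 175 l. 24–36) and Step (x) ("the same … indeterminacies", p. 180 l. 43 – p. 181
  l. 32) consume on the étale side; the reading hypothesis of Step (xi-f) is likewise orbit-well-defined
  (`twistGlue_qRegion_mem_possibleImages_iff`).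
* §4 (Ind3) REINDEX: pre-composing the glue's `m`-index by any `e : ℤ ≃ ℤ` (the "variation in `m`" whose
  union is the only invariantly defined datum, Thm. 3.11 (ii) upper semi-compatibility, p. 156) leaves
  `thetaRegion3` and every output unchanged (`reindexGlue_statement_iff`) — Step (iv)'s log-Kummer
  correspondence consumes exactly this (p. 176 l. 17–36).

What this file deliberately does NOT contain (TEAM C division, plan/C312-TEAMS.md): volume invariance of
`indGroup` elements (B-2: generator ⇒ group closure with `LogvolInvariant`), per-step `Obs` readings (Team A),
the identified-copies reading (Team R), any claim that the (xi-f) inclusion follows from this invariance —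
it does not (c312-4 `mainGoal_is_the_extra_input`; `ForkInd1Passive.setLevel_forces_active`; c312-6
`verbatim_edge_not_imp_readings`). Nothing here asserts Cor. 3.12.
[claim: Mochizuki2012, status: disputed] for the quoted clauses; bookkeeping proofs are [folklore].
-/

noncomputable section

namespace Summit.ABC.IUTFork.Cor312

open Thm311 Literature.IUT.LogThetaLattice

namespace Setting

variable {T : ThetaIndex} {S : Situation T} (P : Setting S)

/-! ## 1. The indeterminacy group permutes the possible images -/

/-- Composition in the family group is pointwise composition of the linear automorphisms (the group
structure `Cor312.indGroup` lives in: `Pi.group` over `LinearEquiv.automorphismGroup`). [folklore] -/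
theorem coe_mul_apply (Φ Ψ : S.L.PacketAut) (j : T.Label) (vQ : T.VQ) :
    ⇑((Φ * Ψ) j vQ) = ⇑(Φ j vQ) ∘ ⇑(Ψ j vQ) := by
  funext x
  rfl

/-- Inversion in the family group is pointwise `LinearEquiv.symm`. [folklore] -/
theorem coe_inv_apply (Φ : S.L.PacketAut) (j : T.Label) (vQ : T.VQ) :
    ⇑(Φ⁻¹ j vQ) = ⇑((Φ j vQ).symm) := rfl

/-- Images under an automorphism and its inverse cancel on subsets of a packet. [folklore] -/
theorem image_symm_image (Φ : S.L.PacketAut) (j : T.Label) (vQ : T.VQ) (A : Set (S.L.Packet j vQ)) :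
    ⇑((Φ j vQ).symm) '' (⇑(Φ j vQ) '' A) = A := by
  rw [Set.image_image]
  simp only [LinearEquiv.symm_apply_apply, Set.image_id']

/-- An element of the indeterminacy group carries each possible image of the Θ-pilot object to a possible
image: the family `possibleImages` ([IUTchIII] Cor. 3.12, p. 173 l. 49 – p. 174 l. 3) is stable under the
very indeterminacies it is built from. [folklore] -/
theorem image_mem_possibleImages {j : T.Label} {vQ : T.VQ} {Φ : S.L.PacketAut}
    (hΦ : Φ ∈ indGroup S) {U : Set (S.L.Packet j vQ)} (hU : U ∈ P.possibleImages j vQ) :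
    Φ j vQ '' U ∈ P.possibleImages j vQ := by
  obtain ⟨Ψ, hΨ, rfl⟩ := hU
  refine ⟨Φ * Ψ, (indGroup S).mul_mem hΦ hΨ, ?_⟩
  rw [coe_mul_apply, Set.image_comp]

/-- **The indeterminacy group PERMUTES the possible images**: the image under `Φ ∈ indGroup S` of the family
of possible images is the family itself ([IUTchIII] Thm. 3.11 (i): the representation is "regarded up to"
(Ind1), (Ind2); Dupuy–Hilado §4.11 `U_Θ = Ind2(Ind1((O_𝕃(−P_Θ))^{Ind3}))`). [folklore] -/
theorem image_possibleImages_eq {j : T.Label} {vQ : T.VQ} {Φ : S.L.PacketAut}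
    (hΦ : Φ ∈ indGroup S) :
    (Set.image ⇑(Φ j vQ)) '' P.possibleImages j vQ = P.possibleImages j vQ := by
  refine Set.Subset.antisymm ?_ ?_
  · rintro _ ⟨U, hU, rfl⟩
    exact P.image_mem_possibleImages hΦ hU
  · intro U hU
    refine ⟨Φ⁻¹ j vQ '' U, P.image_mem_possibleImages ((indGroup S).inv_mem hΦ) hU, ?_⟩
    rw [coe_inv_apply, Set.image_image]
    simp only [LinearEquiv.apply_symm_apply, Set.image_id']

/-- **SELF-INVARIANCE of the union of the possible images**: the set whose holomorphic hull carries
`−|log(Θ)|` (`^{n,∘}𝒰_{j,v_ℚ}` before the hull, proof of Cor. 3.12 p. 174 l. 50 – p. 175 l. 1) is a FIXED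
POINT of every indeterminacy in `indGroup S`. The typed content of "which we regard as subject to the
indeterminacies (Ind1), (Ind2)": nothing further is gained by applying them again. [folklore] -/
theorem image_sUnion_possibleImages {j : T.Label} {vQ : T.VQ} {Φ : S.L.PacketAut}
    (hΦ : Φ ∈ indGroup S) :
    Φ j vQ '' ⋃₀ P.possibleImages j vQ = ⋃₀ P.possibleImages j vQ := by
  conv_rhs => rw [← P.image_possibleImages_eq hΦ (j := j) (vQ := vQ)]
  rw [Set.sUnion_image, Set.image_sUnion, Set.sUnion_image]

/-! ## 2. Output-data congruence: settings with the same frames, column and q-data and the same possible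
images have the same two printed quantities -/

section Congruence

variable (P' : Setting S)

/-- Congruence of `HullDefined` ([IUTchIII] Rmk. 3.9.5 (i) well-definedness side conditions) under equality
of frames and of possible images. [folklore] -/
theorem hullDefined_congr (hframe : ∀ j vQ, P'.frame j vQ = P.frame j vQ)
    (hpi : ∀ j vQ, P'.possibleImages j vQ = P.possibleImages j vQ) (j : T.Label) (vQ : T.VQ) :
    P'.HullDefined j vQ ↔ P.HullDefined j vQ := by
  unfold HullDefined
  rw [hframe j vQ, hpi j vQ]

/-- Congruence of the holomorphic hull `^{n,∘}𝒰_{j,v_ℚ}` (proof of Cor. 3.12, p. 174 l. 50 – p. 175 l. 1).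
[folklore] -/
theorem thetaHull_congr (hframe : ∀ j vQ, P'.frame j vQ = P.frame j vQ)
    (hpi : ∀ j vQ, P'.possibleImages j vQ = P.possibleImages j vQ) (j : T.Label) (vQ : T.VQ) :
    P'.thetaHull j vQ = P.thetaHull j vQ := by
  unfold thetaHull
  rw [hframe j vQ, hpi j vQ]

/-- Congruence of the local Θ-contribution `thetaLocal` (the mono-analytic log-volume of the hull, Thm.
3.11 (i) (a) / Prop. 3.9 (ii)) under equality of column, frames and possible images. [folklore] -/
theorem thetaLocal_congr (hn : P'.n = P.n) (hframe : ∀ j vQ, P'.frame j vQ = P.frame j vQ)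
    (hpi : ∀ j vQ, P'.possibleImages j vQ = P.possibleImages j vQ) (j : T.Label) (vQ : T.VQ) :
    P'.thetaLocal j vQ = P.thetaLocal j vQ := by
  have hd := hullDefined_congr P P' hframe hpi j vQ
  have hh := thetaHull_congr P P' hframe hpi j vQ
  unfold thetaLocal
  by_cases h : P.HullDefined j vQ
  · rw [if_pos h, if_pos (hd.mpr h), hh, hn]
  · rw [if_neg h, if_neg fun hc => h (hd.mp hc)]

/-- Congruence of the finiteness clause `ThetaFinite` ("`−|log(Θ)| ∈ ℝ`" side conditions, proof of Cor. 3.12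
p. 175 l. 2–4). [folklore] -/
theorem thetaFinite_congr (hn : P'.n = P.n) (hframe : ∀ j vQ, P'.frame j vQ = P.frame j vQ)
    (hpi : ∀ j vQ, P'.possibleImages j vQ = P.possibleImages j vQ) :
    P'.ThetaFinite ↔ P.ThetaFinite := by
  have hl : P'.thetaLocal = P.thetaLocal :=
    funext fun j => funext fun vQ => thetaLocal_congr P P' hn hframe hpi j vQ
  unfold ThetaFinite
  rw [hl]

/-- **Congruence of `−|log(Θ)|`** (Cor. 3.12, p. 173 l. 43 – p. 174 l. 3): settings with the same column,
hull frames and possible images have the same Θ-side quantity. [folklore] -/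
theorem negLogTheta_congr (hn : P'.n = P.n) (hframe : ∀ j vQ, P'.frame j vQ = P.frame j vQ)
    (hpi : ∀ j vQ, P'.possibleImages j vQ = P.possibleImages j vQ) :
    P'.negLogTheta = P.negLogTheta := by
  have hl : P'.thetaLocal = P.thetaLocal :=
    funext fun j => funext fun vQ => thetaLocal_congr P P' hn hframe hpi j vQ
  have hf := thetaFinite_congr P P' hn hframe hpi
  unfold negLogTheta
  by_cases h : P.ThetaFinite
  · rw [if_pos h, if_pos (hf.mpr h), hl]
  · rw [if_neg h, if_neg fun hc => h (hf.mp hc)]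

/-- **Congruence of `−|log(q)|`** (Cor. 3.12, p. 174 l. 4–10) under equality of column and q-regions.
[folklore] -/
theorem negLogQ_congr (hn : P'.n = P.n) (hq : ∀ j vQ, P'.qRegion j vQ = P.qRegion j vQ) :
    P'.negLogQ = P.negLogQ := by
  unfold negLogQ qLocal
  rw [hn]
  congr 1
  funext i
  exact finsum_congr fun vQ => by rw [hq]

/-- **Congruence of the printed conclusion** (Cor. 3.12, p. 174 l. 16–18): settings with the same column,
hull frames, q-regions and possible images satisfy the statement together or not at all — the OUTPUT of the
multiradial algorithm depends only on those four data. [folklore] -/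
theorem statement_congr (hn : P'.n = P.n) (hframe : ∀ j vQ, P'.frame j vQ = P.frame j vQ)
    (hpi : ∀ j vQ, P'.possibleImages j vQ = P.possibleImages j vQ)
    (hq : ∀ j vQ, P'.qRegion j vQ = P.qRegion j vQ) :
    P'.Statement ↔ P.Statement := by
  unfold Statement
  rw [negLogTheta_congr P P' hn hframe hpi, negLogQ_congr P P' hn hq]

/-- Congruence of the printed `C_Θ`-rephrasing (p. 174 l. 18–19). [folklore] -/
theorem cThetaForm_congr (hn : P'.n = P.n) (hframe : ∀ j vQ, P'.frame j vQ = P.frame j vQ)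
    (hpi : ∀ j vQ, P'.possibleImages j vQ = P.possibleImages j vQ)
    (hq : ∀ j vQ, P'.qRegion j vQ = P.qRegion j vQ) :
    P'.CThetaForm ↔ P.CThetaForm := by
  unfold CThetaForm absLogQ
  rw [negLogTheta_congr P P' hn hframe hpi, negLogQ_congr P P' hn hq]

end Congruence

/-! ## 3. The Kummer-glue twist: functorial invariance under (Ind1), (Ind2) -/

/-- The setting whose Θ-side Kummer glue is POST-COMPOSED by a family `Φ₀` of packet automorphisms: each
Kummer image `thetaRegionOf m` (Thm. 3.11 (ii) at lattice position `(n, m)`; RESIDUAL R1 of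
`Cor312Statement.lean`) is replaced by its `Φ₀`-translate. For `Φ₀ ∈ indGroup S` this is the re-choice of
the Kummer identification within the indeterminacy (Ind1), (Ind2) that Cor. 3.12 declares itself subject to;
everything else — theaters, lattice, pilot objects, hull frames, the q-side glue — is untouched.
[claim: Mochizuki2012, status: disputed] -/
def twistGlue (Φ₀ : S.L.PacketAut) : Setting S :=
  { P with thetaRegionOf := fun m ob j vQ => Φ₀ j vQ '' P.thetaRegionOf m ob j vQ }

section TwistGlue

variable (Φ₀ : S.L.PacketAut)

/-- The twist keeps the column. [folklore] -/
theorem twistGlue_n : (P.twistGlue Φ₀).n = P.n := rfl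

/-- The twist keeps the hull frames. [folklore] -/
theorem twistGlue_frame (j : T.Label) (vQ : T.VQ) : (P.twistGlue Φ₀).frame j vQ = P.frame j vQ := rfl

/-- The twist keeps the Θ-pilot object (only its images move). [folklore] -/
theorem twistGlue_thetaPilot : (P.twistGlue Φ₀).thetaPilot = P.thetaPilot := rfl

/-- The twist keeps the q-side glue and the q-pilot image ("which we do *not* regard as subject to the
indeterminacies", Cor. 3.12 p. 174 l. 8–10). [folklore] -/
theorem twistGlue_qRegion (j : T.Label) (vQ : T.VQ) :
    (P.twistGlue Φ₀).qRegion j vQ = P.qRegion j vQ := rfl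

/-- The twisted Kummer image at `(m, j, v_ℚ)` is the `Φ₀`-translate. [folklore] -/
theorem twistGlue_thetaRegion (m : ℤ) (j : T.Label) (vQ : T.VQ) :
    (P.twistGlue Φ₀).thetaRegion m j vQ = Φ₀ j vQ '' P.thetaRegion m j vQ := rfl

/-- The twisted (Ind3)-enlarged region is the `Φ₀`-translate of the original (image commutes with the union
over `m ∈ ℤ`). [folklore] -/
theorem twistGlue_thetaRegion3 (j : T.Label) (vQ : T.VQ) :
    (P.twistGlue Φ₀).thetaRegion3 j vQ = Φ₀ j vQ '' P.thetaRegion3 j vQ := by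
  unfold thetaRegion3
  simp only [twistGlue_thetaRegion, Set.image_iUnion]

/-- **ORBIT ABSORPTION**: for `Φ₀ ∈ indGroup S` the twisted setting has exactly the same possible images —
the orbit `{Φ '' (Φ₀ '' R) | Φ ∈ indGroup}` IS the orbit `{Φ '' R | Φ ∈ indGroup}`. This is the precise
sense in which the family "possible images of a Θ-pilot object" is independent of the choice of Kummer
representative within its (Ind1)(Ind2)-class. [folklore] -/
theorem twistGlue_possibleImages (hΦ₀ : Φ₀ ∈ indGroup S) (j : T.Label) (vQ : T.VQ) :
    (P.twistGlue Φ₀).possibleImages j vQ = P.possibleImages j vQ := by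
  unfold possibleImages
  ext U
  simp only [Set.mem_setOf_eq, twistGlue_thetaRegion3]
  constructor
  · rintro ⟨Φ, hΦ, rfl⟩
    refine ⟨Φ * Φ₀, (indGroup S).mul_mem hΦ hΦ₀, ?_⟩
    rw [coe_mul_apply, Set.image_comp]
  · rintro ⟨Φ, hΦ, rfl⟩
    refine ⟨Φ * Φ₀⁻¹, (indGroup S).mul_mem hΦ ((indGroup S).inv_mem hΦ₀), ?_⟩
    rw [coe_mul_apply, Set.image_comp, coe_inv_apply, image_symm_image]

/-- **THE KUMMER-GLUE TWIST THEOREM, Θ-side quantity**: `−|log(Θ)|` is unchanged by re-choosing the Kummer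
identification within its (Ind1)(Ind2)-indeterminacy — the multiradial algorithm's Θ-side output is
well-defined on the `R^LGP`-class, as the statement of Cor. 3.12 requires of itself (p. 173 l. 49 – p. 174
l. 3). Pure orbit algebra; no volume hypothesis. [folklore] -/
theorem twistGlue_negLogTheta (hΦ₀ : Φ₀ ∈ indGroup S) :
    (P.twistGlue Φ₀).negLogTheta = P.negLogTheta :=
  negLogTheta_congr P (P.twistGlue Φ₀) rfl (fun _ _ => rfl) (P.twistGlue_possibleImages Φ₀ hΦ₀)

/-- The twist does not move `−|log(q)|` (the q-pilot image is not subject to the indeterminacies).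
[folklore] -/
theorem twistGlue_negLogQ : (P.twistGlue Φ₀).negLogQ = P.negLogQ :=
  negLogQ_congr P (P.twistGlue Φ₀) rfl fun _ _ => rfl

/-- **THE KUMMER-GLUE TWIST THEOREM**: the printed conclusion of Cor. 3.12 holds for the twisted setting
iff it holds for the original — the STATEMENT is functorially invariant under the indeterminacies (Ind1),
(Ind2) acting on the Kummer glue. This is the étale-picture well-definedness consumed by Steps (ii) and (x)
of the proof (p. 175 l. 24–36, p. 180 l. 43 – p. 181 l. 32): no step changes the two quantities by moving
the Θ-pilot's images within their indeterminacy class. [folklore] -/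
theorem twistGlue_statement_iff (hΦ₀ : Φ₀ ∈ indGroup S) :
    (P.twistGlue Φ₀).Statement ↔ P.Statement :=
  statement_congr P (P.twistGlue Φ₀) rfl (fun _ _ => rfl) (P.twistGlue_possibleImages Φ₀ hΦ₀)
    fun _ _ => rfl

/-- The `C_Θ`-rephrasing is likewise twist-invariant. [folklore] -/
theorem twistGlue_cThetaForm_iff (hΦ₀ : Φ₀ ∈ indGroup S) :
    (P.twistGlue Φ₀).CThetaForm ↔ P.CThetaForm :=
  cThetaForm_congr P (P.twistGlue Φ₀) rfl (fun _ _ => rfl) (P.twistGlue_possibleImages Φ₀ hΦ₀)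
    fun _ _ => rfl

/-- The READING HYPOTHESIS of Step (xi-f) — "the q-pilot image is among the possible images"
(`statement_of_qRegion_mem_possibleImages`, `Cor312StatementBridge.lean`) — is itself orbit-well-defined:
it holds for the twisted glue iff it holds for the original. Whether it HOLDS is not touched here (it is
the disputed content: c312-4 `mainGoal_is_the_extra_input`; Team A row A-4 / Team R row R-1). [folklore] -/
theorem twistGlue_qRegion_mem_possibleImages_iff (hΦ₀ : Φ₀ ∈ indGroup S) (j : T.Label) (vQ : T.VQ) :
    (P.twistGlue Φ₀).qRegion j vQ ∈ (P.twistGlue Φ₀).possibleImages j vQ ↔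
      P.qRegion j vQ ∈ P.possibleImages j vQ := by
  rw [P.twistGlue_possibleImages Φ₀ hΦ₀ j vQ]
  exact Iff.rfl

end TwistGlue

/-! ## 4. The (Ind3) reindex: the union over `m ∈ ℤ` absorbs any re-indexing of the Kummer tower -/

/-- The setting whose Θ-side Kummer glue is PRE-COMPOSED by a bijection `e : ℤ ≃ ℤ` of the lattice
`m`-indices — the "variation in `m`" of the Kummer isomorphisms whose images only enter Cor. 3.12 through
their union ((Ind3), Thm. 3.11 (ii), p. 156: upper semi-compatibility; the union is the only invariantly
defined datum). [claim: Mochizuki2012, status: disputed] -/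
def reindexGlue (e : ℤ ≃ ℤ) : Setting S :=
  { P with thetaRegionOf := fun m => P.thetaRegionOf (e m) }

section ReindexGlue

variable (e : ℤ ≃ ℤ)

/-- The reindexed Kummer image at `m` is the original at `e m`. [folklore] -/
theorem reindexGlue_thetaRegion (m : ℤ) (j : T.Label) (vQ : T.VQ) :
    (P.reindexGlue e).thetaRegion m j vQ = P.thetaRegion (e m) j vQ := rfl

/-- **(Ind3) ABSORPTION**: the (Ind3)-enlarged region is invariant under any re-indexing of the Kummer
tower — `⋃_{m} thetaRegion (e m) = ⋃_{m} thetaRegion m`. [folklore] -/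
theorem reindexGlue_thetaRegion3 (j : T.Label) (vQ : T.VQ) :
    (P.reindexGlue e).thetaRegion3 j vQ = P.thetaRegion3 j vQ := by
  show (⋃ m : ℤ, P.thetaRegion (e m) j vQ) = ⋃ m : ℤ, P.thetaRegion m j vQ
  refine Set.Subset.antisymm
    (Set.iUnion_subset fun m => Set.subset_iUnion (fun m' : ℤ => P.thetaRegion m' j vQ) (e m))
    (Set.iUnion_subset fun m => ?_)
  simpa using Set.subset_iUnion (fun m' : ℤ => P.thetaRegion (e m') j vQ) (e.symm m)

/-- The reindexed setting has the same possible images. [folklore] -/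
theorem reindexGlue_possibleImages (j : T.Label) (vQ : T.VQ) :
    (P.reindexGlue e).possibleImages j vQ = P.possibleImages j vQ := by
  unfold possibleImages
  simp only [reindexGlue_thetaRegion3]

/-- **THE (Ind3) REINDEX THEOREM**: the printed conclusion of Cor. 3.12 is invariant under re-indexing the
Kummer tower — the step of the proof that passes through the log-Kummer correspondence (Step (iv), p. 176
l. 17–36) consumes exactly this invariance of the union over `m`. [folklore] -/
theorem reindexGlue_statement_iff : (P.reindexGlue e).Statement ↔ P.Statement :=
  statement_congr P (P.reindexGlue e) rfl (fun _ _ => rfl) (P.reindexGlue_possibleImages e)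
    fun _ _ => rfl

/-- `−|log(Θ)|` is reindex-invariant. [folklore] -/
theorem reindexGlue_negLogTheta : (P.reindexGlue e).negLogTheta = P.negLogTheta :=
  negLogTheta_congr P (P.reindexGlue e) rfl (fun _ _ => rfl) (P.reindexGlue_possibleImages e)

end ReindexGlue

end Setting

end Summit.ABC.IUTFork.Cor312

end
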